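import Mathlib.Analysis.SpecialFunctions.Integrals.Basic
import Literature.Analysis.FluidPDE.LuoHou2014BoundaryScenario
import HarnessLib

/-!
# Choi–Hou–Kiselev–Luo–Šverák–Yao 2017: the PERIODIC Hou–Luo wall model has no global smooth
# solution from odd data with the printed sign structure — the model, the data class, one named
# fact, and the Luo–Hou wall datum inside the class

HONEST FRAMING (cell ns-blowup GROUP B «PROFILE SEARCH»; zones Z3-b′ / Z8 = the Hou–Luo boundary
model; human rulings D-0035/D-0074/D-0081): **1-D MODEL (Hou–Luo), not Euler/NS.** The HL model is a
model of the 3D axisymmetric Euler equations restricted to the wall `r = 1` of the cylinder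
(`x ↔ z`, `θ ↔ (u^θ)²`, `ω ↔ ω^θ`, `u ↔ u^z`); nothing in this file is a statement about Euler or
Navier–Stokes. The companion file `HouLuoModelSelfSimilarBlowup.lean` types the model on the LINE
(`IsHouLuoLineSolution`, compactly supported data; facts `chenHouHuang2022_houLuo_blowup` and
`huangQinWangWei2025_selfSimilarHouLuo`); this file types the **periodic** setting — the geometry of
Luo–Hou's `z`-periodic cylinder — and the sign-class blow-up theorem of

* K. Choi, T. Y. Hou, A. Kiselev, G. Luo, V. Šverák, Y. Yao, *On the finite-time blowup of a
  one-dimensional model for the three-dimensional axisymmetric Euler equations*, Comm. Pure Appl.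
  Math. **70** (2017) 2218–2243 = arXiv:1407.4776 [ChoiHouKiselevLuoSverakYao2017] ("p." = chunk of
  the held arXiv text).

## What is printed

§1 (p. 3): the HL model `ω_t + uω_x = θ_x`, `θ_t + uθ_x = 0`, Biot–Savart law `u_x = Hω`, on `ℝ` or on
the circle `S¹`. §2.1 **Theorem 1** (p. 6): "Both in the periodic case (`x ∈ S¹`) and in the real-line
case (`x ∈ ℝ`) with compactly supported initial data `(θ_{0x}, ω₀)`, one can find smooth initial
conditions such that the HL-model cannot have a smooth global solution starting from those data."
§4 (p. 11, the periodic setting on `[0, L]`): `u_x = Hω(x) = (1/L)∫₀^L ω(y)cot[μ(x−y)]dy`, `μ = π/L`,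
so that "the nonlocal velocity `u` is defined by `u(x) = Qω(x) := (1/π)∫₀^L ω(y) log|sin[μ(x−y)]| dy`";
data: "smooth odd periodic initial data `θ_{0x}, ω₀` with period `L` … we suppose `θ_{0x}, ω₀ ≥ 0` on
`[0, L/2]` … we may assume `θ₀(0) = 0`"; "the evolution preserves the assumptions as long as the
solution exists"; the functional `I(t) := ∫₀^{L/2} θ(x,t) cot(μx) dx` "must blow up in finite time if
`I(0) > 0`. As will be shown below, this implies the blowup of the HL-model": Lemma 6 (the kernel
`K(x,y) = s log|(s+1)/(s−1)|`, `s = tan(μy)/tan(μx)`, `K ≥ 0`, `K ≥ 2` for `x < y`), Lemma 7 (positivity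
of `∫_a^{L/2} ω (u cot(μx))_x`), and the proof of Theorem 1 (p. 12–13): `I ≤ C‖θ_x‖_∞ ≤
C‖θ_{0x}‖_∞ exp ∫₀ᵗ‖u_x‖_∞`, so blow-up of `I` forces blow-up of `∫₀ᵗ‖u_x‖_∞` and, by the BKM-type
criterion (p. 6), the loss of smoothness; `dI/dt ≥ J`, `dJ/dt ≥ (2/L²)I²`, `I = (g′)^{1/2}` blows up in
finite time. §3.3 **Theorem 4** (p. 9) and Choi–Kiselev–Yao, Comm. Math. Phys. 334 (2015)
[ChoiKiselevYao2015] Thm 1.1: the CKY model (`u(x) = −x∫_x^1 ω(y)/y dy` on `[0,1]`, resp.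
`−x∫_x^∞` on `ℝ₊`) blows up in finite time from `C_c^∞` data. §4 first paragraph and Chen–Hou–Huang
2022 §2 (arXiv:2106.05422 p. 25): these sign conditions "are consistent with the initial data
considered by Luo–Hou restricted on the boundary".

## What this file types

* `periodicHLVelocity L ω x = Qω(x)` (definition with body: the absolutely convergent log-kernel form
  printed on p. 11; its derivative is the periodic Hilbert transform `Hω`, not needed by the system);
  `IsPeriodicHouLuoSolution L ω θ T` — classical `L`-periodic solutions on `ℝ × [0, T)`, the exact
  analogue of `IsHouLuoLineSolution` with `lineVelocity ↦ periodicHLVelocity L`;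
  `IsGlobalSmoothPeriodicHouLuoSolution L ω₀ θ₀ ω θ` — a smooth (`C^∞` on `t ≥ 0`) solution for all
  times from the data; the CKY velocity law `ckyVelocity` (definition, Thm 4 / CKY Thm 1.1 quoted).
* `ChoiEtAl2017.cotFunctional L θ = I` and the printed DATA CLASS `ChoiEtAl2017.IsBlowupDatum L ω₀ θ₀`
  (`L > 0`; `θ₀, ω₀ ∈ C^∞`, `L`-periodic; `θ_{0x}, ω₀` odd and `≥ 0` on `[0, L/2]`; `θ₀(0) = 0`;
  `I(0) > 0`).
* ONE NAMED FACT `choiEtAl2017_periodicHouLuo_blowup` — Theorem 1, periodic case, in the class form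
  that §4 proves: NO datum of the class launches a global smooth `L`-periodic solution.
* PROVED: non-vacuity of the solution predicate (`isPeriodicHouLuoSolution_zero`); the class is
  inhabited — the cosine datum `θ₀ = 1 − cos(2πx/L)`, `ω₀ = sin(2πx/L)` has `I(0) = L/π`
  (`ChoiEtAl2017.isBlowupDatum_cosine`), whence **Theorem 1 (periodic) verbatim**
  (`choiEtAl2017_periodicHouLuo_blowup.exists_datum`); and **the Luo–Hou wall datum is in the class**:
  `θ₀ = (u₁⁰(1,z))² = 10⁴ sin²(2πz/L)` (`LuoHou2014.wallModelInitialU`, `LuoHou2014BoundaryScenario.lean`),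
  `ω₀ = 0`, with period `L/2 = 1/12` (the data's finer symmetry: `θ_{0z} ∝ sin(4πz/L) ≥ 0` exactly on
  `[0, L/4]`) and `I(0) = 2500·L/π` (`ChoiEtAl2017.isBlowupDatum_luoHouWall`,
  `cotFunctional_luoHouWall`) ⇒ `choiEtAl2017_periodicHouLuo_blowup.luoHou_wallModel`: given the fact,
  the periodic HL MODEL launched from the Luo–Hou wall trace has no global smooth `L/2`-periodic
  solution — the printed remark made a kernel implication.

Faithfulness notes. (1) Theorem 1 is printed as an existence statement ("one can find smooth initial
conditions"); §4 proves the class statement ("we consider smooth odd periodic initial data … Proof of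
Theorem 1"), which is what the fact records, with every hypothesis of p. 11; the existence form is the
proved corollary. (2) "Smooth global solution" is rendered as: classical `L`-periodic solution on
`[0, T)` for every `T` (`IsPeriodicHouLuoSolution`, slices `ω(t) ∈ C¹`, `θ(t) ∈ C²`) AND `ω, θ` jointly
`C^∞` on `{t ≥ 0} × ℝ` — a subclass of the paper's smooth solutions, so the fact is not stronger than
print. (3) The real-line half of Theorem 1 is not vendored here (the line model's blow-up from
smooth compactly supported data is already the fact `chenHouHuang2022_houLuo_blowup`, a different and
stronger theorem; CHKLSY's line statement would be a third fact with no consumer). (4) The BKM-type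
continuation criteria (p. 6, "see Danchin 2013 … adapted in a straightforward way") and local
well-posedness are used by the printed proof and are not separately vendored.

WHAT THIS IS NOT: not Euler, not Navier–Stokes; not a statement about the Luo–Hou 3-D computation —
only about the 1-D periodic wall MODEL; the one fact is a published theorem quoted with its
hypotheses, everything else is definitional or proved arithmetic/calculus.
-/

noncomputable section

open Set Filter Real MeasureTheory intervalIntegral
open _root_.Topology

namespace Literature.Analysis.FluidPDE

/-! ### The periodic Hou–Luo model (CHKLSY §4) -/

/-- **The periodic HL velocity** `u = Qω`, `Qω(x) := (1/π) ∫₀^L ω(y) log|sin(π(x−y)/L)| dy` (p. 11,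
display (eqn_m_hl_u); `μ = π/L`; `u_x = Hω` is the periodic Hilbert transform). The logarithmic
kernel is integrable, so this is an ordinary interval integral. [cite: ChoiHouKiselevLuoSverakYao2017, §4 p. 11 (u = Qω)] -/
def periodicHLVelocity (L : ℝ) (ω : ℝ → ℝ) (x : ℝ) : ℝ :=
  1 / π * ∫ y in (0 : ℝ)..L, ω y * Real.log |Real.sin (π * (x - y) / L)|

/-- `Q 0 = 0`. [cite: ChoiHouKiselevLuoSverakYao2017, §4 p. 11 (u = Qω)] -/
theorem periodicHLVelocity_zero (L x : ℝ) : periodicHLVelocity L 0 x = 0 := by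
  simp [periodicHLVelocity]

/-- **A CLASSICAL `L`-PERIODIC SOLUTION of the Hou–Luo model on `ℝ × [0, T)`** (§1 (hl) with the §4
Biot–Savart law): `ω_t + uω_x = θ_x`, `θ_t + uθ_x = 0`, `u = Qω(t, ·)`, time first (`ω t x`):
(i) for `t ∈ [0,T)` the slices `ω t ∈ C¹`, `θ t ∈ C²` are `L`-periodic; (ii) the orbits are continuous
within `[0,∞)` at `t = 0` (data attained); (iii) for `t ∈ (0,T)` and every `x` the time derivatives
exist and equal `−uω_x + θ_x` and `−uθ_x`. The exact analogue of `IsHouLuoLineSolution`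
(`HouLuoModelSelfSimilarBlowup.lean`) with `lineVelocity ↦ periodicHLVelocity L`.
[cite: ChoiHouKiselevLuoSverakYao2017, §1 (hl) p. 3 and §4 p. 11] -/
def IsPeriodicHouLuoSolution (L : ℝ) (ω θ : ℝ → ℝ → ℝ) (T : ℝ) : Prop :=
  (∀ t ∈ Ico 0 T, ContDiff ℝ 1 (ω t) ∧ ContDiff ℝ 2 (θ t) ∧
      Function.Periodic (ω t) L ∧ Function.Periodic (θ t) L) ∧
  (∀ x : ℝ, ContinuousWithinAt (fun t => ω t x) (Ici 0) 0 ∧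
    ContinuousWithinAt (fun t => θ t x) (Ici 0) 0) ∧
  ∀ t ∈ Ioo 0 T, ∀ x : ℝ,
    HasDerivAt (fun s => ω s x)
      (-(periodicHLVelocity L (ω t) x * deriv (ω t) x) + deriv (θ t) x) t ∧
    HasDerivAt (fun s => θ s x) (-(periodicHLVelocity L (ω t) x * deriv (θ t) x)) t

/-- Restriction in time. [cite: ChoiHouKiselevLuoSverakYao2017, §1 (hl) p. 3 and §4 p. 11] -/
theorem IsPeriodicHouLuoSolution.mono {L : ℝ} {ω θ : ℝ → ℝ → ℝ} {T T' : ℝ}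
    (h : IsPeriodicHouLuoSolution L ω θ T) (hT : T' ≤ T) : IsPeriodicHouLuoSolution L ω θ T' :=
  ⟨fun t ht => h.1 t ⟨ht.1, lt_of_lt_of_le ht.2 hT⟩, h.2.1,
    fun t ht => h.2.2 t ⟨ht.1, lt_of_lt_of_le ht.2 hT⟩⟩

/-- Non-vacuity: the rest state `ω = θ = 0` is a periodic HL solution on every `[0, T)`.
[cite: ChoiHouKiselevLuoSverakYao2017, §1 (hl) p. 3] -/
theorem isPeriodicHouLuoSolution_zero (L T : ℝ) : IsPeriodicHouLuoSolution L 0 0 T := by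
  refine ⟨fun t _ => ⟨contDiff_const, contDiff_const, fun x => rfl, fun x => rfl⟩,
    fun x => ⟨continuousWithinAt_const, continuousWithinAt_const⟩, fun t _ x => ⟨?_, ?_⟩⟩
  · simpa using hasDerivAt_const t (0 : ℝ)
  · simpa using hasDerivAt_const t (0 : ℝ)

/-- **A GLOBAL SMOOTH `L`-periodic solution from the data `(ω₀, θ₀)`**: a classical periodic solution
on `[0, T)` for every `T > 0`, jointly `C^∞` in `(t, x)` on `{t ≥ 0}`, with `ω(0) = ω₀`, `θ(0) = θ₀`
("smooth global solution starting from those data", Thm 1). [cite: ChoiHouKiselevLuoSverakYao2017, §2.1 Thm 1 p. 6] -/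
def IsGlobalSmoothPeriodicHouLuoSolution (L : ℝ) (ω₀ θ₀ : ℝ → ℝ) (ω θ : ℝ → ℝ → ℝ) : Prop :=
  (∀ T : ℝ, 0 < T → IsPeriodicHouLuoSolution L ω θ T) ∧
  ContDiffOn ℝ (⊤ : ℕ∞) (fun p : ℝ × ℝ => ω p.1 p.2) {p | 0 ≤ p.1} ∧
  ContDiffOn ℝ (⊤ : ℕ∞) (fun p : ℝ × ℝ => θ p.1 p.2) {p | 0 ≤ p.1} ∧
  ω 0 = ω₀ ∧ θ 0 = θ₀

/-- **The CKY velocity law** `u(x) = −x ∫_x^1 ω(y)/y dy` on `[0, 1]` (Choi–Kiselev–Yao 2015, the model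
system of §1; CHKLSY §1 (bscky): `u ∼ −x∫_x^∞ ω/y` on `ℝ₊`), the local simplification of `Q` with
`(u/x)_x = ω/x`; with this `u` the system `ω_t + uω_x = θ_x`, `θ_t + uθ_x = 0` "develops a singularity in
finite time" from `C_c^∞` data with `θ_{0x}, ω₀ ≥ 0` (CKY 2015 Thm 1.1: `∫₀^{T*}‖ω‖_∞ = ∞`; CHKLSY
Thm 4, entropy proof). Definition only; the theorems are quoted, not vendored.
[cite: ChoiKiselevYao2015, §1 (model system) and Thm 1.1] [cite: ChoiHouKiselevLuoSverakYao2017, §1 (bscky) p. 3 and §3.3 Thm 4 p. 9] -/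
def ckyVelocity (ω : ℝ → ℝ) (x : ℝ) : ℝ :=
  -x * ∫ y in x..(1 : ℝ), ω y / y

/-- `u_CKY(0) = 0` (the wall corner is a stagnation point of the model velocity).
[cite: ChoiKiselevYao2015, §1 (model system)] -/
theorem ckyVelocity_zero (ω : ℝ → ℝ) : ckyVelocity ω 0 = 0 := by
  simp [ckyVelocity]

namespace ChoiEtAl2017

/-! ### The blow-up functional and the printed data class (§4 p. 11) -/

/-- **CHKLSY's functional** `I(θ) = ∫₀^{L/2} θ(x) cot(πx/L) dx` (p. 11 (eqn_def_I), `μ = π/L`); along a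
solution `I(t) = I(θ(t))`. [cite: ChoiHouKiselevLuoSverakYao2017, §4 p. 11 (I(t))] -/
def cotFunctional (L : ℝ) (θ : ℝ → ℝ) : ℝ :=
  ∫ x in (0 : ℝ)..L / 2, θ x * Real.cot (π * x / L)

/-- **The printed data class of the periodic blow-up theorem** (p. 11): period `L > 0`; `θ₀, ω₀`
smooth and `L`-periodic; "`θ_{0x}, ω₀` odd … with period `L`"; "`θ_{0x}, ω₀ ≥ 0` on `[0, L/2]`";
"`θ₀(0) = 0`" (a normalisation, the system being invariant under `θ ↦ θ + const`); and `I(0) > 0`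
("must blow up in finite time if `I(0) > 0`"). [cite: ChoiHouKiselevLuoSverakYao2017, §4 p. 11 (assumptions on the data)] -/
structure IsBlowupDatum (L : ℝ) (ω₀ θ₀ : ℝ → ℝ) : Prop where
  /-- the period is positive -/
  L_pos : 0 < L
  /-- `ω₀ ∈ C^∞` -/
  smooth_ω : ContDiff ℝ (⊤ : ℕ∞) ω₀
  /-- `θ₀ ∈ C^∞` -/
  smooth_θ : ContDiff ℝ (⊤ : ℕ∞) θ₀
  /-- `ω₀` is `L`-periodic -/
  periodic_ω : Function.Periodic ω₀ L
  /-- `θ₀` is `L`-periodic -/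
  periodic_θ : Function.Periodic θ₀ L
  /-- `ω₀` is odd -/
  odd_ω : Function.Odd ω₀
  /-- `θ_{0x}` is odd -/
  odd_dθ : Function.Odd (deriv θ₀)
  /-- `ω₀ ≥ 0` on `[0, L/2]` -/
  ω_nonneg : ∀ x ∈ Icc 0 (L / 2), 0 ≤ ω₀ x
  /-- `θ_{0x} ≥ 0` on `[0, L/2]` -/
  dθ_nonneg : ∀ x ∈ Icc 0 (L / 2), 0 ≤ deriv θ₀ x
  /-- `θ₀(0) = 0` -/
  θ_zero : θ₀ 0 = 0
  /-- `I(0) > 0` -/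
  functional_pos : 0 < cotFunctional L θ₀

end ChoiEtAl2017

/-! ### The named fact: CHKLSY Theorem 1, periodic case, class form of §4 -/

/-- **Choi–Hou–Kiselev–Luo–Šverák–Yao 2017, Theorem 1 (periodic case), in the form proved in §4**
(CPAM 70 (2017) 2218 = arXiv:1407.4776; Thm 1 p. 6: "in the periodic case (`x ∈ S¹`) … one can
find smooth initial conditions such that the HL-model cannot have a smooth global solution starting
from those data"; §4 p. 11–13 proves it for EVERY datum of the class `ChoiEtAl2017.IsBlowupDatum`:
`I(t) = ∫₀^{L/2}θ cot(μx)` blows up in finite time, `I ≤ C‖θ_{0x}‖_∞ exp∫₀ᵗ‖u_x‖_∞`, BKM-type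
criterion). **Statement**: for every period `L` and every datum `(ω₀, θ₀)` of the class there is NO
global smooth `L`-periodic solution of the HL model (`IsGlobalSmoothPeriodicHouLuoSolution`: classical
on every `[0,T)`, jointly `C^∞` on `t ≥ 0`, attaining the data). Not stronger than print (faithfulness
notes (1)–(2) of the module docstring). 1-D MODEL of the Euler wall scenario, not Euler/NS.
[cite: ChoiHouKiselevLuoSverakYao2017, §2.1 Thm 1 p. 6 and §4 pp. 11–13 (proof of Thm 1, periodic setting)] -/
def choiEtAl2017_periodicHouLuo_blowup : Prop :=
  ∀ (L : ℝ) (ω₀ θ₀ : ℝ → ℝ), ChoiEtAl2017.IsBlowupDatum L ω₀ θ₀ →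
    ∀ ω θ : ℝ → ℝ → ℝ, ¬ IsGlobalSmoothPeriodicHouLuoSolution L ω₀ θ₀ ω θ

namespace ChoiEtAl2017

/-! ### The class is inhabited: the cosine datum (hence Theorem 1 as printed) -/

/-- The trigonometric identity behind both examples: `(1 − cos 2a)·cot a = sin 2a` for every real `a`
(at the zeros of `sin a` both sides vanish, `cot` taking its junk value). [folklore] -/
private theorem one_sub_cos_two_mul_mul_cot (a : ℝ) :
    (1 - Real.cos (2 * a)) * Real.cot a = Real.sin (2 * a) := by
  rw [Real.cos_two_mul, Real.sin_two_mul, Real.cot_eq_cos_div_sin]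
  by_cases hs : Real.sin a = 0
  · simp [hs]
  · rw [← mul_div_assoc, div_eq_iff hs]
    linear_combination (-2 * Real.cos a) * Real.sin_sq_add_cos_sq a

/-- `sin² a · cot a = sin a cos a` for every real `a`. [folklore] -/
private theorem sin_sq_mul_cot (a : ℝ) :
    Real.sin a ^ 2 * Real.cot a = Real.sin a * Real.cos a := by
  rw [Real.cot_eq_cos_div_sin]
  by_cases hs : Real.sin a = 0
  · simp [hs]
  · field_simp

/-- The cosine temperature datum `θ₀(x) = 1 − cos(2πx/L)`. [cite: ChoiHouKiselevLuoSverakYao2017, §4 p. 11 (assumptions on the data)] -/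
def cosineTheta (L x : ℝ) : ℝ := 1 - Real.cos (2 * π * x / L)

/-- The sine vorticity datum `ω₀(x) = sin(2πx/L)`. [cite: ChoiHouKiselevLuoSverakYao2017, §4 p. 11 (assumptions on the data)] -/
def cosineOmega (L x : ℝ) : ℝ := Real.sin (2 * π * x / L)

/-- `θ₀′(x) = (2π/L) sin(2πx/L)`. [folklore] -/
private theorem hasDerivAt_cosineTheta (L x : ℝ) :
    HasDerivAt (cosineTheta L) (2 * π / L * Real.sin (2 * π * x / L)) x := by
  have h1 : HasDerivAt (fun x : ℝ => 2 * π * x / L) (2 * π / L) x := by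
    simpa using ((hasDerivAt_id x).const_mul (2 * π)).div_const L
  have h2 : HasDerivAt (fun x : ℝ => 1 - Real.cos (2 * π * x / L))
      (-(-Real.sin (2 * π * x / L) * (2 * π / L))) x := (h1.cos).const_sub 1
  exact h2.congr_deriv (by ring)

/-- `θ₀′ = (2π/L) sin(2π·/L)` as a function. [folklore] -/
private theorem deriv_cosineTheta (L : ℝ) :
    deriv (cosineTheta L) = fun x => 2 * π / L * Real.sin (2 * π * x / L) :=
  funext fun x => (hasDerivAt_cosineTheta L x).deriv

/-- On `[0, L/2]` (`L > 0`) the phase `2πx/L` lies in `[0, π]`, so `sin(2πx/L) ≥ 0`. [folklore] -/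
private theorem sin_phase_nonneg {L x : ℝ} (hL : 0 < L) (hx : x ∈ Icc 0 (L / 2)) :
    0 ≤ Real.sin (2 * π * x / L) := by
  apply Real.sin_nonneg_of_nonneg_of_le_pi
  · exact div_nonneg (by nlinarith [pi_pos, hx.1]) hL.le
  · rw [div_le_iff₀ hL]
    nlinarith [pi_pos, hx.2]

/-- **`I(0) = L/π` for the cosine datum**: the integrand is `(1 − cos(2μx))cot(μx) = sin(2μx)`,
`μ = π/L`, whose integral over `[0, L/2]` is `L/π`. [cite: ChoiHouKiselevLuoSverakYao2017, §4 p. 11 (I(t))] -/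
theorem cotFunctional_cosineTheta {L : ℝ} (hL : 0 < L) :
    cotFunctional L (cosineTheta L) = L / π := by
  have hL0 : L ≠ 0 := hL.ne'
  have hpi : π ≠ 0 := pi_pos.ne'
  have heq : ∀ x : ℝ, cosineTheta L x * Real.cot (π * x / L) = Real.sin (2 * (π * x / L)) := by
    intro x
    rw [cosineTheta, show 2 * π * x / L = 2 * (π * x / L) by ring]
    exact one_sub_cos_two_mul_mul_cot _
  unfold cotFunctional
  rw [intervalIntegral.integral_congr fun x _ => heq x]
  -- antiderivative `F(x) = −(L/(2π)) cos(2πx/L)`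
  have hF : ∀ x ∈ uIcc (0 : ℝ) (L / 2),
      HasDerivAt (fun x : ℝ => -(L / (2 * π)) * Real.cos (2 * (π * x / L)))
        (Real.sin (2 * (π * x / L))) x := by
    intro x _
    have h1 : HasDerivAt (fun x : ℝ => 2 * (π * x / L)) (2 * (π / L)) x := by
      have := ((hasDerivAt_id x).const_mul π).div_const L
      simpa using this.const_mul 2
    have h2 : HasDerivAt (fun x : ℝ => -(L / (2 * π)) * Real.cos (2 * (π * x / L)))
        (-(L / (2 * π)) * (-Real.sin (2 * (π * x / L)) * (2 * (π / L)))) x := (h1.cos).const_mul _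
    refine h2.congr_deriv ?_
    have : -(L / (2 * π)) * (2 * (π / L)) = -1 := by field_simp
    linear_combination (-Real.sin (2 * (π * x / L))) * this
  rw [intervalIntegral.integral_eq_sub_of_hasDerivAt hF
    ((Real.continuous_sin.comp (by fun_prop)).intervalIntegrable _ _)]
  have hq : π * (L / 2) / L = π / 2 := by
    rw [mul_div_assoc, show L / 2 / L = 1 / 2 by rw [div_div, mul_comm 2 L, ← div_div, div_self hL0]]
    ring
  have hπ : 2 * (π * (L / 2) / L) = π := by rw [hq]; ring
  simp only [hπ, mul_zero, zero_div, Real.cos_pi, Real.cos_zero]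
  have : L / (2 * π) * 2 = L / π := by field_simp
  linear_combination this

/-- **The cosine datum is in CHKLSY's class** for every `L > 0` (`θ₀ = 1 − cos(2πx/L)`,
`ω₀ = sin(2πx/L)`: smooth, `L`-periodic, `θ_{0x} = (2π/L)ω₀` and `ω₀` odd and `≥ 0` on `[0, L/2]`,
`θ₀(0) = 0`, `I(0) = L/π > 0`). [cite: ChoiHouKiselevLuoSverakYao2017, §4 p. 11 (assumptions on the data)] -/
theorem isBlowupDatum_cosine {L : ℝ} (hL : 0 < L) :
    IsBlowupDatum L (cosineOmega L) (cosineTheta L) where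
  L_pos := hL
  smooth_ω := by
    unfold cosineOmega
    exact Real.contDiff_sin.comp ((contDiff_const.mul contDiff_id).div_const L)
  smooth_θ := by
    unfold cosineTheta
    exact contDiff_const.sub (Real.contDiff_cos.comp ((contDiff_const.mul contDiff_id).div_const L))
  periodic_ω := by
    intro x
    have h : 2 * π * (x + L) / L = 2 * π * x / L + 2 * π := by field_simp
    simp only [cosineOmega, h, Real.sin_add_two_pi]
  periodic_θ := by
    intro x
    have h : 2 * π * (x + L) / L = 2 * π * x / L + 2 * π := by field_simp
    simp only [cosineTheta, h, Real.cos_add_two_pi]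
  odd_ω := by
    intro x
    simp only [cosineOmega, mul_neg, neg_div, Real.sin_neg]
  odd_dθ := by
    intro x
    simp only [deriv_cosineTheta, mul_neg, neg_div, Real.sin_neg, mul_neg]
  ω_nonneg := fun x hx => sin_phase_nonneg hL hx
  dθ_nonneg := fun x hx => by
    rw [deriv_cosineTheta]
    exact mul_nonneg (div_nonneg (by positivity) hL.le) (sin_phase_nonneg hL hx)
  θ_zero := by simp [cosineTheta]
  functional_pos := by
    rw [cotFunctional_cosineTheta hL]
    positivity

end ChoiEtAl2017

/-- **Theorem 1 (periodic case) as printed**, from the fact: for every period `L > 0` "one can find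
smooth initial conditions such that the HL-model cannot have a smooth global solution starting from
those data" — witnessed by the cosine datum. [cite: ChoiHouKiselevLuoSverakYao2017, §2.1 Thm 1 p. 6] -/
theorem choiEtAl2017_periodicHouLuo_blowup.exists_datum (h : choiEtAl2017_periodicHouLuo_blowup)
    {L : ℝ} (hL : 0 < L) :
    ∃ ω₀ θ₀ : ℝ → ℝ, ContDiff ℝ (⊤ : ℕ∞) ω₀ ∧ ContDiff ℝ (⊤ : ℕ∞) θ₀ ∧
      Function.Periodic ω₀ L ∧ Function.Periodic θ₀ L ∧
      ∀ ω θ : ℝ → ℝ → ℝ, ¬ IsGlobalSmoothPeriodicHouLuoSolution L ω₀ θ₀ ω θ :=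
  have hd := ChoiEtAl2017.isBlowupDatum_cosine hL
  ⟨_, _, hd.smooth_ω, hd.smooth_θ, hd.periodic_ω, hd.periodic_θ, h L _ _ hd⟩

namespace ChoiEtAl2017

/-! ### The Luo–Hou wall datum is in the class (with the period `L/2` of its finer symmetry) -/

/-- The Luo–Hou wall-model datum `θ₀(z) = 10⁴ sin²(2πz/L)` (`LuoHou2014.wallModelInitialU`,
`L = LuoHou2014.periodL = 1/6`) is `L/2`-periodic. [cite: LuoHou2014, §5 (arXiv:1310.0497 p0024 L40)] -/
theorem periodic_wallModelInitialU_half :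
    Function.Periodic LuoHou2014.wallModelInitialU (LuoHou2014.periodL / 2) := by
  intro z
  have hL : LuoHou2014.periodL ≠ 0 := LuoHou2014.periodL_pos.ne'
  have h : 2 * π * (z + LuoHou2014.periodL / 2) / LuoHou2014.periodL =
      2 * π * z / LuoHou2014.periodL + π := by
    field_simp
  simp only [LuoHou2014.wallModelInitialU, h, Real.sin_add_pi, neg_sq]

/-- `θ₀′(z) = 10⁴ · 2 sin(2πz/L) cos(2πz/L) · (2π/L)` for the Luo–Hou wall datum
`θ₀ = 10⁴ sin²(2πz/L)`. [cite: LuoHou2014, §5 (arXiv:1310.0497 p0024 L40: the wall-model datum)] -/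
theorem hasDerivAt_wallModelInitialU (z : ℝ) :
    HasDerivAt LuoHou2014.wallModelInitialU
      (10 ^ 4 * (2 * Real.sin (2 * π * z / LuoHou2014.periodL) *
        (Real.cos (2 * π * z / LuoHou2014.periodL) * (2 * π / LuoHou2014.periodL)))) z := by
  have h1 : HasDerivAt (fun z : ℝ => 2 * π * z / LuoHou2014.periodL) (2 * π / LuoHou2014.periodL) z := by
    simpa using ((hasDerivAt_id z).const_mul (2 * π)).div_const LuoHou2014.periodL
  have h2 : HasDerivAt (fun z : ℝ => (10 : ℝ) ^ 4 * Real.sin (2 * π * z / LuoHou2014.periodL) ^ 2)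
      ((10 : ℝ) ^ 4 * (((2 : ℕ) : ℝ) * Real.sin (2 * π * z / LuoHou2014.periodL) ^ (2 - 1) *
        (Real.cos (2 * π * z / LuoHou2014.periodL) * (2 * π / LuoHou2014.periodL)))) z :=
    ((h1.sin).pow 2).const_mul _
  exact h2.congr_deriv (by norm_num)

/-- The derivative of the Luo–Hou wall datum as a function: `θ₀′(z) = (2π·10⁴/L)·2 sin cos`.
[cite: LuoHou2014, §5 (arXiv:1310.0497 p0024 L40: the wall-model datum)] -/
theorem deriv_wallModelInitialU :
    deriv LuoHou2014.wallModelInitialU = fun z =>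
      10 ^ 4 * (2 * Real.sin (2 * π * z / LuoHou2014.periodL) *
        (Real.cos (2 * π * z / LuoHou2014.periodL) * (2 * π / LuoHou2014.periodL))) :=
  funext fun z => (hasDerivAt_wallModelInitialU z).deriv

/-- **`I(0) = 2500·L/π` for the Luo–Hou wall datum with the period `L/2`**: the integrand is
`10⁴ sin²(b) cot(b) = 10⁴ sin b cos b = 5000 sin 2b`, `b = 2πz/L`, integrated over `[0, L/4]`.
[cite: ChoiHouKiselevLuoSverakYao2017, §4 p. 11 (I(t))] [cite: LuoHou2014, §5 (arXiv:1310.0497 p0024 L40)] -/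
theorem cotFunctional_luoHouWall :
    cotFunctional (LuoHou2014.periodL / 2) LuoHou2014.wallModelInitialU =
      2500 * LuoHou2014.periodL / π := by
  set L := LuoHou2014.periodL with hLdef
  have hL : 0 < L := LuoHou2014.periodL_pos
  have hL0 : L ≠ 0 := hL.ne'
  have hpi : π ≠ 0 := pi_pos.ne'
  have heq : ∀ z : ℝ, LuoHou2014.wallModelInitialU z * Real.cot (π * z / (L / 2)) =
      5000 * Real.sin (2 * (2 * π * z / L)) := by
    intro z
    have hb : π * z / (L / 2) = 2 * π * z / L := by rw [div_div_eq_mul_div]; ring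
    rw [LuoHou2014.wallModelInitialU, ← hLdef, hb, mul_assoc, sin_sq_mul_cot, Real.sin_two_mul]
    ring
  unfold cotFunctional
  rw [show L / 2 / 2 = L / 4 by ring, intervalIntegral.integral_congr fun z _ => heq z]
  have hF : ∀ z ∈ uIcc (0 : ℝ) (L / 4),
      HasDerivAt (fun z : ℝ => -(5000 * (L / (4 * π))) * Real.cos (2 * (2 * π * z / L)))
        (5000 * Real.sin (2 * (2 * π * z / L))) z := by
    intro z _
    have h1 : HasDerivAt (fun z : ℝ => 2 * (2 * π * z / L)) (2 * (2 * π / L)) z := by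
      have := ((hasDerivAt_id z).const_mul (2 * π)).div_const L
      simpa using this.const_mul 2
    have h2 : HasDerivAt (fun z : ℝ => -(5000 * (L / (4 * π))) * Real.cos (2 * (2 * π * z / L)))
        (-(5000 * (L / (4 * π))) * (-Real.sin (2 * (2 * π * z / L)) * (2 * (2 * π / L)))) z :=
      (h1.cos).const_mul _
    refine h2.congr_deriv ?_
    have : L / (4 * π) * (2 * (2 * π / L)) = 1 := by field_simp; ring
    linear_combination (5000 * Real.sin (2 * (2 * π * z / L))) * this
  rw [intervalIntegral.integral_eq_sub_of_hasDerivAt hF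
    ((continuous_const.mul (Real.continuous_sin.comp (by fun_prop))).intervalIntegrable _ _)]
  have hq : 2 * π * (L / 4) / L = π / 2 := by
    rw [mul_div_assoc, show L / 4 / L = 1 / 4 by rw [div_div, mul_comm 4 L, ← div_div, div_self hL0]]
    ring
  have hπ : 2 * (2 * π * (L / 4) / L) = π := by rw [hq]; ring
  simp only [hπ, mul_zero, zero_div, Real.cos_pi, Real.cos_zero]
  have : 5000 * (L / (4 * π)) * 2 = 2500 * L / π := by field_simp; ring
  linear_combination this

/-- **The Luo–Hou wall datum lies in CHKLSY's blow-up class** with the period `L/2 = 1/12` (CHKLSY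
§4: the sign conditions "are consistent with the initial data considered by Luo–Hou restricted on the
boundary" — Chen–Hou–Huang 2022 §2): `θ₀ = (u₁⁰(1,z))² = 10⁴ sin²(2πz/L)` (`LuoHou2014.wallModelInitialU`,
`LuoHou2014.initialU1_wall_sq`), `ω₀ = ω₁⁰(1, ·) = 0`; `θ_{0z} ∝ sin(4πz/L)` is odd and `≥ 0` exactly on
`[0, L/4]`, `θ₀(0) = 0`, `I(0) = 2500L/π > 0`. [cite: ChoiHouKiselevLuoSverakYao2017, §4 p. 11 (assumptions on the data)] [cite: LuoHou2014, §5 (arXiv:1310.0497 p0024 L40)] -/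
theorem isBlowupDatum_luoHouWall :
    IsBlowupDatum (LuoHou2014.periodL / 2) 0 LuoHou2014.wallModelInitialU where
  L_pos := half_pos LuoHou2014.periodL_pos
  smooth_ω := contDiff_const
  smooth_θ := by
    unfold LuoHou2014.wallModelInitialU
    exact contDiff_const.mul
      ((Real.contDiff_sin.comp ((contDiff_const.mul contDiff_id).div_const _)).pow 2)
  periodic_ω := fun z => rfl
  periodic_θ := periodic_wallModelInitialU_half
  odd_ω := fun z => by simp
  odd_dθ := by
    intro z
    simp only [deriv_wallModelInitialU, mul_neg, neg_div, Real.sin_neg, Real.cos_neg, neg_mul,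
      mul_neg]
  ω_nonneg := fun z _ => le_rfl
  dθ_nonneg := by
    intro z hz
    have hL := LuoHou2014.periodL_pos
    rw [show LuoHou2014.periodL / 2 / 2 = LuoHou2014.periodL / 4 by ring] at hz
    have hb0 : 0 ≤ 2 * π * z / LuoHou2014.periodL :=
      div_nonneg (by nlinarith [pi_pos, hz.1]) hL.le
    have hb1 : 2 * π * z / LuoHou2014.periodL ≤ π / 2 := by
      rw [div_le_iff₀ hL]
      nlinarith [pi_pos, hz.2]
    have hs : 0 ≤ Real.sin (2 * π * z / LuoHou2014.periodL) :=
      Real.sin_nonneg_of_nonneg_of_le_pi hb0 (by linarith [pi_pos])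
    have hc : 0 ≤ Real.cos (2 * π * z / LuoHou2014.periodL) :=
      Real.cos_nonneg_of_mem_Icc ⟨by linarith [pi_pos], hb1⟩
    rw [deriv_wallModelInitialU]
    have h2 : 0 ≤ 2 * π / LuoHou2014.periodL := div_nonneg (by positivity) hL.le
    positivity
  θ_zero := by simp [LuoHou2014.wallModelInitialU]
  functional_pos := by
    rw [cotFunctional_luoHouWall]
    have := LuoHou2014.periodL_pos
    positivity

/-- With `L = 1/6`: `I(0) = 2500/(6π)` for the Luo–Hou wall datum. [cite: LuoHou2014, §4 (L = 1/6) and §5] -/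
theorem cotFunctional_luoHouWall_eq :
    cotFunctional (LuoHou2014.periodL / 2) LuoHou2014.wallModelInitialU = 2500 / (6 * π) := by
  rw [cotFunctional_luoHouWall, LuoHou2014.periodL]
  ring

end ChoiEtAl2017

/-- **The periodic HL MODEL launched from the Luo–Hou wall trace has no global smooth solution**
(given the fact): datum `(ω₀, θ₀) = (0, 10⁴ sin²(2πz/L))` = `(ω₁⁰(1,·), (u₁⁰(1,·))²)` of Luo–Hou's
computation restricted to the wall `r = 1`, period `L/2`. The printed remark (CHKLSY §4 / CHH 2022 §2:
the class conditions "are consistent with the initial data considered by Luo–Hou restricted on the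
boundary") as a kernel implication. A statement about the 1-D wall MODEL, not about the 3-D Euler
computation. [cite: ChoiHouKiselevLuoSverakYao2017, §2.1 Thm 1 p. 6 and §4 p. 11] [cite: LuoHou2014, §5 (arXiv:1310.0497 p0024 L40)] -/
theorem choiEtAl2017_periodicHouLuo_blowup.luoHou_wallModel (h : choiEtAl2017_periodicHouLuo_blowup)
    (ω θ : ℝ → ℝ → ℝ) :
    ¬ IsGlobalSmoothPeriodicHouLuoSolution (LuoHou2014.periodL / 2) 0 LuoHou2014.wallModelInitialU ω θ :=
  h _ _ _ ChoiEtAl2017.isBlowupDatum_luoHouWall ω θ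

end Literature.Analysis.FluidPDE

end
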